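import Literature.AnabelianGeometry.AbsoluteAnabelian.UnitKummerCyclotomeJunction
import Literature.AnabelianGeometry.AbsoluteAnabelian.GaloisCyclotomeReciprocityFundamental
import HarnessLib

/-!
# [AbsTopIII] Prop 3.3 (i) clause (c): THE junction `Λ(k̄ˣ) ≃* μ_Ẑ(G_k)` on the FUNDAMENTAL reciprocity datum,
# and the presented unit Kummer theories against it — DEFINITIONS

S. Mochizuki, *Topics in absolute anabelian geometry III*, §3, Prop. 3.3 (i) p. 73 (bib key `MochizukiAbsTopIII2015`):
«the natural isomorphism `μ_Ẑ(M) ⥲ μ_Ẑ(G)` [cf. Remark 3.2.1] is only determined up to a `{±1}`- (respectively, `Ẑ^×`-)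
multiple if `T = TLG` (respectively, `T = TCG`)»; Rmk. 3.2.1 p. 73: THE natural `μ_Ẑ(M_TM) ⥲ μ_Ẑ(G)`, «compatibility with the
natural isomorphism of Corollary 1.10, (a)»; [AbsAnab] Prop. 1.2.1 (vi) p. 10–11 (bib key `MochizukiAbsAnab2004`): THE
identification `μ_{ℚ/ℤ}(G_K) ≅ μ_{ℚ/ℤ}(K̄)` of local class field theory.

abc-iut cell, layer L4, node AbsTopIII:Prop3.3(i), row «P33i-TLG-FUND-JUNCTION» (seat abc-iut-w4-d009 gen 5).  DEFINITIONS +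
`rfl` unfoldings only; the theorems (choice-freeness, the `{±1}`-robustness, exact dependence on the datum, equivariance) are
the proof-only companion `UnitKummerCyclotomeJunctionFundamentalProofs.lean`.  State of the tree: the presented unit Kummer
theories against the group-theoretic `μ_Ẑ(G_k)` (`TLG/TCGPresentation.unitKummerTheoryMuZhat`, p432997) are built on CHOSEN
torsion reciprocity data (`MLFClosure.reciprocityData = Classical.choice _`); abc-iut-w6-d022's
`GaloisCyclotomeReciprocityFundamental.lean` (p437130) singles out THE datum `TorsionReciprocityData.fundamental k` (local class
field theory; unique ON THE NOSE, `IsFundamental.unique`) and asks junction files to use it.  Here: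

* `MLFClosure.cyclotomeUnitsEquivMuZhatOf C D` — the junction `Λ(k̄ˣ) ≃* μ_Ẑ(G_k)` of an ARBITRARY datum `D` (p432997's chosen
  junction is `…Of C.reciprocityData`, rfl); **`MLFClosure.cyclotomeUnitsEquivMuZhatFund C`** — THE junction (`D = fundamental k`);
* **`GaloisMonoidPair.TLGPresentation.unitKummerTheoryMuZhatFund π`** (and `…Of π D`; `TCGPresentation.unitKummerTheoryMuZhatFund`)
  — the presented unit Kummer theory with cyclotome target `μ_Ẑ(G_k)` through THE junction: Kummer maps unchanged (rfl), class =
  the composites through THE junction (rfl); this is the object Prop. 3.3 (i) clause (c) speaks of.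

HONEST FRAMING: classical (local class field theory + Kummer theory at OUR model objects); nothing here bears on [IUTchIII]
Cor. 3.12; no side taken; typed ≠ proved.
-/

noncomputable section

namespace Literature.AnabelianGeometry.AbsoluteAnabelian

universe u

/-! ### The junction of an arbitrary datum; THE junction -/

namespace MLFClosure

variable (C : MLFClosure.{u})

/-- The junction `Λ(k̄ˣ) ≃* μ_Ẑ(G_k)` built from a torsion reciprocity datum `D`: `Λ` of the units of `k̄ ≃ k^alg`, then
`(D.muZhatEquiv)⁻¹`. [cite: MochizukiAbsTopIII2015, Remark 3.2.1 p.73] -/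
def cyclotomeUnitsEquivMuZhatOf (D : TorsionReciprocityData C.k) :
    EtaleTheta.cyclotome (C.K)ˣ ≃* muZhat (Field.absoluteGaloisGroup C.k) :=
  (MonoidKummerTheory.cyclotomeCongr C.closureMulEquivAlgClosure).trans D.muZhatEquiv.symm

/-- The chosen junction of p432997 is the junction of the chosen datum. [cite: MochizukiAbsTopIII2015, Remark 3.2.1 p.73] -/
theorem cyclotomeUnitsEquivMuZhat_eq_of : C.cyclotomeUnitsEquivMuZhat = C.cyclotomeUnitsEquivMuZhatOf C.reciprocityData := rfl

/-- **THE junction `Λ(k̄ˣ) ≃* μ_Ẑ(G_k)`**: the junction of THE (fundamental, local-class-field-theory normalised) datum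
`TorsionReciprocityData.fundamental k` of abc-iut-w6-d022 — print's natural identification of [AbsAnab] Prop. 1.2.1 (vi) /
[AbsTopIII] Cor. 1.10 (a), read on `Λ(−)`. [cite: MochizukiAbsTopIII2015, Remark 3.2.1 p.73] -/
def cyclotomeUnitsEquivMuZhatFund : EtaleTheta.cyclotome (C.K)ˣ ≃* muZhat (Field.absoluteGaloisGroup C.k) :=
  C.cyclotomeUnitsEquivMuZhatOf (TorsionReciprocityData.fundamental C.k)

/-- Unfolding. [cite: MochizukiAbsTopIII2015, Remark 3.2.1 p.73] -/
theorem cyclotomeUnitsEquivMuZhatFund_eq_of :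
    C.cyclotomeUnitsEquivMuZhatFund = C.cyclotomeUnitsEquivMuZhatOf (TorsionReciprocityData.fundamental C.k) := rfl

/-- Components of the inverse junction of a datum `D`: `ε⁻¹` of the components of `D.muZhatEquiv`.
[cite: MochizukiAbsTopIII2015, Remark 3.2.1 p.73] -/
theorem cyclotomeUnitsEquivMuZhatOf_symm_apply_coe (D : TorsionReciprocityData C.k)
    (η : muZhat (Field.absoluteGaloisGroup C.k)) (n : ℕ+) :
    ((((C.cyclotomeUnitsEquivMuZhatOf D).symm η : EtaleTheta.cyclotome (C.K)ˣ) : ℕ+ → (C.K)ˣ) n : C.K) =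
      (IsAlgClosure.equiv C.k C.K (AlgebraicClosure C.k)).symm
        (((D.muZhatEquiv η : EtaleTheta.cyclotome (AlgebraicClosure C.k)ˣ) :
          ℕ+ → (AlgebraicClosure C.k)ˣ) n : AlgebraicClosure C.k) :=
  rfl

end MLFClosure

/-! ### The presented unit Kummer theories against `μ_Ẑ(G_k)` through THE junction -/

namespace GaloisMonoidPair

namespace TLGPresentation

variable {P : GaloisMonoidPair.{0}} (π : P.TLGPresentation)

/-- The presented `TLG` unit Kummer theory re-targeted along the junction of a datum `D`.
[cite: MochizukiAbsTopIII2015, Proposition 3.3 (i) p.73] -/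
def unitKummerTheoryMuZhatOf (D : TorsionReciprocityData π.C.k) : UnitKummerTheory .TLG P :=
  π.unitKummerTheory.mapCyclotome (π.C.cyclotomeUnitsEquivMuZhatOf D)

/-- **THE presented `TLG` unit Kummer theory with cyclotome target `μ_Ẑ(G_k)`**: re-targeting along THE junction
(fundamental datum).  This is the object Prop. 3.3 (i) speaks of: its class of identifications `μ_Ẑ(M) ⥲ μ_Ẑ(G)` is print's
natural one «up to a `{±1}`-multiple». [cite: MochizukiAbsTopIII2015, Proposition 3.3 (i) p.73] -/
def unitKummerTheoryMuZhatFund : UnitKummerTheory .TLG P :=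
  π.unitKummerTheoryMuZhatOf (TorsionReciprocityData.fundamental π.C.k)

/-- p432997's chosen-datum theory is `…Of` the chosen datum. [cite: MochizukiAbsTopIII2015, Proposition 3.3 (i) p.73] -/
theorem unitKummerTheoryMuZhat_eq_of : π.unitKummerTheoryMuZhat = π.unitKummerTheoryMuZhatOf π.C.reciprocityData := rfl

/-- Unfolding. [cite: MochizukiAbsTopIII2015, Proposition 3.3 (i) p.73] -/
theorem unitKummerTheoryMuZhatFund_eq_of :
    π.unitKummerTheoryMuZhatFund = π.unitKummerTheoryMuZhatOf (TorsionReciprocityData.fundamental π.C.k) := rfl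

/-- The cyclotome target of `…Of D` IS `μ_Ẑ(G_k)`. [cite: MochizukiAbsTopIII2015, Proposition 3.3 (i) p.73] -/
theorem unitKummerTheoryMuZhatOf_muG (D : TorsionReciprocityData π.C.k) :
    (π.unitKummerTheoryMuZhatOf D).muG = muZhat (Field.absoluteGaloisGroup π.C.k) := rfl

/-- The Kummer maps of `…Of D` are those of `π.unitKummerTheory`. [cite: MochizukiAbsTopIII2015, Proposition 3.3 (i) p.73] -/
theorem unitKummerTheoryMuZhatOf_kummer (D : TorsionReciprocityData π.C.k) :
    (π.unitKummerTheoryMuZhatOf D).kummer = π.unitKummerTheory.kummer := rfl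

/-- Its cyclotome target IS `μ_Ẑ(G_k)`. [cite: MochizukiAbsTopIII2015, Proposition 3.3 (i) p.73] -/
theorem unitKummerTheoryMuZhatFund_muG : π.unitKummerTheoryMuZhatFund.muG = muZhat (Field.absoluteGaloisGroup π.C.k) := rfl

/-- Its Kummer maps are those of `π.unitKummerTheory` (so the naturality/canonicity files apply verbatim).
[cite: MochizukiAbsTopIII2015, Proposition 3.3 (i) p.73] -/
theorem unitKummerTheoryMuZhatFund_kummer : π.unitKummerTheoryMuZhatFund.kummer = π.unitKummerTheory.kummer := rfl

/-- Its colimit Kummer map is that of `π.unitKummerTheory`. [cite: MochizukiAbsTopIII2015, Proposition 3.3 (i) p.73] -/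
theorem unitKummerTheoryMuZhatFund_kummerLim : π.unitKummerTheoryMuZhatFund.kummerLim = π.unitKummerTheory.kummerLim := rfl

/-- Its cyclotome class: the composites `μ_Ẑ(M) ⥲ Λ(k̄ˣ) ≃* μ_Ẑ(G_k)` through THE junction.
[cite: MochizukiAbsTopIII2015, Proposition 3.3 (i) p.73] -/
theorem unitKummerTheoryMuZhatFund_cycIsoClass :
    π.unitKummerTheoryMuZhatFund.cycIsoClass =
      (fun e => e.trans π.C.cyclotomeUnitsEquivMuZhatFund) '' π.unitKummerTheory.cycIsoClass :=
  rfl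

end TLGPresentation

namespace TCGPresentation

variable {P : GaloisMonoidPair.{0}} (π : P.TCGPresentation)

/-- **THE presented `TCG` unit Kummer theory with cyclotome target `μ_Ẑ(G_k)`** (THE junction; for `TCG` the choice never
mattered — `Ẑ^×`-torsor — see the companion). [cite: MochizukiAbsTopIII2015, Proposition 3.3 (i) p.73] -/
def unitKummerTheoryMuZhatFund : UnitKummerTheory .TCG P :=
  π.unitKummerTheory.mapCyclotome π.C.cyclotomeUnitsEquivMuZhatFund

/-- Its cyclotome target IS `μ_Ẑ(G_k)`. [cite: MochizukiAbsTopIII2015, Proposition 3.3 (i) p.73] -/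
theorem unitKummerTheoryMuZhatFund_muG : π.unitKummerTheoryMuZhatFund.muG = muZhat (Field.absoluteGaloisGroup π.C.k) := rfl

/-- Its Kummer maps are those of `π.unitKummerTheory`. [cite: MochizukiAbsTopIII2015, Proposition 3.3 (i) p.73] -/
theorem unitKummerTheoryMuZhatFund_kummer : π.unitKummerTheoryMuZhatFund.kummer = π.unitKummerTheory.kummer := rfl

/-- Its cyclotome class: the composites through THE junction. [cite: MochizukiAbsTopIII2015, Proposition 3.3 (i) p.73] -/
theorem unitKummerTheoryMuZhatFund_cycIsoClass :
    π.unitKummerTheoryMuZhatFund.cycIsoClass =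
      (fun e => e.trans π.C.cyclotomeUnitsEquivMuZhatFund) '' π.unitKummerTheory.cycIsoClass :=
  rfl

end TCGPresentation

end GaloisMonoidPair

end Literature.AnabelianGeometry.AbsoluteAnabelian

end
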